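import Literature.AlgebraicGeometry.GroupSchemes.BarsottiTateGroupFixedPartMap
import Literature.AlgebraicGeometry.GroupSchemes.BarsottiTateGroupBaseChange
import Literature.AlgebraicGeometry.GroupSchemes.BarsottiTateGroupIso
import Literature.AlgebraicGeometry.GroupSchemes.GroupSchemeKernelBaseChange
import Literature.AlgebraicGeometry.Morphisms.ClosedImmersionOfEqualRank
import HarnessLib

/-!
# Base change of homomorphisms of Barsotti–Tate groups and of the fixed part of an idempotent

Topic `Literature/AlgebraicGeometry/GroupSchemes`; namespaces `Literature.AlgebraicGeometry.GroupSchemes.IdempotentSplitting` (§1,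
one endomorphism of one `S`-group scheme) and `….BTGroup.Hom` (§2–§4).  Cell `hodgecm-mathlib` (D-0151), FLOOR 0, P6 «MOD programme»
(crux hLiu418 = stmt-HodgeConjecture-24832), organ **(O-BTε) «BT GROUP OF AN IDEMPOTENT» FILE 2 (b)** dealt by the K∕BT desk F0P6d-plan
(2026-09-01T14:56:39Z) for the HEART-fields of `stub_MH` ED. 3 (F0P6a-plan): the `w`-part `Fix ε = ε𝒜[p^∞]` (★ `BTGroup.Hom.fixBTGroup`,
sibling `BarsottiTateGroupFixedPart`) must be read at a geometric special point `Spec κ̄ → Spec 𝒪_Ω` and at the generic point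
`Spec Ω → Spec 𝒪_Ω`; this file proves that forming `Fix ε` COMMUTES WITH BASE CHANGE (up to a canonical isomorphism of Barsotti–Tate
groups) and that the RANK FUNCTION of its layers is the pulled-back one — constant over a local base — so that the rank hypothesis
`hrank` of ★ `fixBTGroup` over `κ̄` is discharged from characteristic `0`.  DEFINITIONS WITH BODIES (`fixBaseChangeIso`, `Hom.baseChange`,
`fixBTGroupBaseChangeIso`) + theorems; no named fact, no instance, no notation, no `sorry`.  HC_CM is proved only modulo the printed
citations until rung 0 closes; nothing here is about HC.

THE PRINT.  [Messing1972] Ch. I (1.1)–(1.6): Barsotti–Tate groups and their homomorphisms are fppf-local notions, stable under every base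
change `G ×_S S′`; [GortzWedhorn2020] (4.15) (p. 116) and Definition 4.45 (2) (p. 117): base change of `S`-group schemes and of kernels
`Ker f = G ×_{H,e} S` («for every `S′`-scheme `T`, `(G ×_S S′)(T) = G(T)`» — so `Ker(f) ×_S S′ = Ker(f ×_S S′)`, ★ `GroupSchemeKernel.baseChangeIso`,
and `Fix ε = Ker(𝟙 ∕ ε)` likewise); [Tate1967] §2 (2.1); [StacksProject] Tag 02KA (the rank of a finite locally free morphism is stable under
base change; constant over a local base: [Matsumura1987] Thm. 7.10 via ★ `finrank_eq_finrank_closedPoint_of_isLocalRing`).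

* §1 (`φ : G → G` over `S`, `g : S′ → S`) `pullback_map_one_div` (`(𝟙∕φ) ×_S S′ = 𝟙 ∕ (φ ×_S S′)`), **`fixBaseChangeIso g φ :
  (Fix φ) ×_S S′ ≅ Fix (φ ×_S S′)`** (`_hom_comp_fixι`, `_inv_comp_map_fixι`, `mono_pullback_map_fixι`, `isMonHom_fixBaseChangeIso_hom∕_inv`),
  `finrank_fix_pullback_map_hom` (the rank of `Fix (φ ×_S S′) → S′` at `s′` is that of `Fix φ → S` at `g s′`).
* §2 **`BTGroup.Hom.baseChange (F : Hom B B′) g : Hom (B ×_S S′) (B′ ×_S S′)`** (`_app`, `baseChange_id`, `baseChange_comp`,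
  idempotency and commutation relations transported: `baseChange_idem`, `baseChange_comm`).
* §3 `finrank_fixLayer_baseChange` (**rank of the layers of `Fix (ε ×_S S′)` = pulled-back rank**), `hrank_baseChange`, and the
  isomorphism of Barsotti–Tate groups **`fixBTGroupBaseChangeIso : (Fix ε) ×_S S′ ≅ Fix (ε ×_S S′)`** (+ `_hom_app_comp_fixLayerι`).
* §4 (local base `S = Spec R`, `R` local) `finrank_fixLayer_eq_finrank_closedPoint` — the rank function of every layer of `Fix ε` is
  CONSTANT, so `hrank` holds on `S` as soon as it holds at one point (`hrank_of_closedPoint`); with §3, at any `S′ → Spec R`.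

## References
* [Messing1972] W. Messing, *The Crystals Associated to Barsotti–Tate Groups*, LNM 264 (1972) — Ch. I (1.1)–(1.6).
* [Tate1967] J. T. Tate, *p-divisible groups* (Driebergen 1966), Springer 1967 — §2 (2.1).
* [GortzWedhorn2020] U. Görtz, T. Wedhorn, *Algebraic Geometry I*, 2nd ed. (2020) — (4.15) p. 116, Definition 4.45 (2) p. 117, Section (4.7).
* [StacksProject] The Stacks Project — Tag 02KA.
* [Matsumura1987] H. Matsumura, *Commutative Ring Theory* — Thm. 7.10.
-/

noncomputable section

-- `fix φ = ker (𝟙 ∕ φ)`, `fixι φ = kerι _`, `(B.baseChange g).G n = (Over.pullback g).obj (B.G n)` are definitional only above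
-- `instances` transparency (as in ★ `BarsottiTateGroupBaseChange`, ★ `GroupSchemeKernelBaseChange`).
set_option backward.isDefEq.respectTransparency false

universe u

open CategoryTheory CategoryTheory.Limits AlgebraicGeometry MonoidalCategory CartesianMonoidalCategory
open scoped MonObj CategoryTheory.Obj

namespace Literature.AlgebraicGeometry.GroupSchemes

/-! ## §1 `Fix` commutes with base change -/

namespace IdempotentSplitting

section BaseChange

variable {S S' : Scheme.{u}} (g : S' ⟶ S) {G : Over S} [GrpObj G] (φ : G ⟶ G)

/-- `fixι` unfolds to the kernel inclusion of `𝟙 ∕ φ`. [cite: GortzWedhorn2020, Definition 4.45 (2) (p. 117)] -/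
theorem fixι_eq_kerι : fixι φ = GroupSchemeKernel.kerι ((𝟙 G) / φ) := rfl

/-- **`(𝟙 ∕ φ) ×_S S′ = 𝟙 ∕ (φ ×_S S′)`**: base change is a monoidal functor, hence a group homomorphism on `Hom(G, G)`
(Mathlib `Functor.homMonoidHom`). [cite: GortzWedhorn2020, (4.15) (p. 116)] -/
theorem pullback_map_one_div :
    (Over.pullback g).map ((𝟙 G) / φ) = (𝟙 ((Over.pullback g).obj G)) / (Over.pullback g).map φ := by
  change (Over.pullback g).homMonoidHom ((𝟙 G) / φ) = _
  rw [map_div]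
  change (Over.pullback g).map (𝟙 G) / (Over.pullback g).map φ = _
  rw [(Over.pullback g).map_id]

/-- `ι_{φ ×_S S′}` is killed by `(𝟙 ∕ φ) ×_S S′` (the hypothesis of `kerLift` into `Ker((𝟙∕φ) ×_S S′) = (Fix φ) ×_S S′`).
[cite: GortzWedhorn2020, Definition 4.45 (2) (p. 117)] -/
theorem fixι_map_comp_map_one_div :
    fixι ((Over.pullback g).map φ) ≫ (Over.pullback g).map ((𝟙 G) / φ) = 1 := by
  rw [pullback_map_one_div, comp_one_div, fixι_comp, div_self']

/-- `(ι_φ) ×_S S′` is fixed by `φ ×_S S′` (functoriality). [cite: GortzWedhorn2020, Definition 4.45 (2) (p. 117)] -/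
theorem map_fixι_comp_map : (Over.pullback g).map (fixι φ) ≫ (Over.pullback g).map φ = (Over.pullback g).map (fixι φ) := by
  rw [← Functor.map_comp, fixι_comp]

/-- `baseChangeIso.inv ≫ (ι_φ) ×_S S′ = ι_{(𝟙∕φ) ×_S S′}` (★ `GroupSchemeKernel.baseChangeIso_inv_comp_map_kerι` in `fixι`-form).
[cite: GortzWedhorn2020, Definition 4.45 (2) (p. 117)] -/
theorem baseChangeIso_inv_comp_map_fixι :
    (GroupSchemeKernel.baseChangeIso g ((𝟙 G) / φ)).inv ≫ (Over.pullback g).map (fixι φ) =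
      GroupSchemeKernel.kerι ((Over.pullback g).map ((𝟙 G) / φ)) :=
  GroupSchemeKernel.baseChangeIso_inv_comp_map_kerι g ((𝟙 G) / φ)

/-- `(ι_φ) ×_S S′` is a monomorphism (an isomorphism followed by the kernel inclusion `ι_{(𝟙∕φ) ×_S S′}`, ★
`GroupSchemeKernel.baseChangeIso_hom_comp_kerι`). [cite: GortzWedhorn2020, Definition 4.45 (2) (p. 117)] -/
theorem mono_pullback_map_fixι : Mono ((Over.pullback g).map (fixι φ)) := by
  rw [fixι_eq_kerι, ← GroupSchemeKernel.baseChangeIso_hom_comp_kerι g ((𝟙 G) / φ)]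
  haveI := GroupSchemeKernel.mono_kerι ((Over.pullback g).map ((𝟙 G) / φ))
  exact mono_comp _ _

/-- **`Fix` COMMUTES WITH BASE CHANGE: `(Fix φ) ×_S S′ ≅ Fix (φ ×_S S′)`** over `S′`, for an endomorphism `φ` of an `S`-group scheme
`G` and `g : S′ → S`.  Forward: the universal property of `Fix (φ ×_S S′)` applied to `(ι_φ) ×_S S′` (fixed by functoriality);
backward: `Fix (φ ×_S S′) = Ker(𝟙 ∕ (φ ×_S S′)) = Ker((𝟙∕φ) ×_S S′) ≅ Ker(𝟙∕φ) ×_S S′` (★ `GroupSchemeKernel.baseChangeIso`).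
[cite: GortzWedhorn2020, (4.15) (p. 116) and Definition 4.45 (2) (p. 117)] [cite: Messing1972, Ch. I (1.1)–(1.6)] -/
def fixBaseChangeIso : (Over.pullback g).obj (fix φ) ≅ fix ((Over.pullback g).map φ) where
  hom := fixLift ((Over.pullback g).map φ) ((Over.pullback g).map (fixι φ)) (map_fixι_comp_map g φ)
  inv := GroupSchemeKernel.kerLift (f := (Over.pullback g).map ((𝟙 G) / φ)) (fixι ((Over.pullback g).map φ))
      (fixι_map_comp_map_one_div g φ) ≫ (GroupSchemeKernel.baseChangeIso g ((𝟙 G) / φ)).inv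
  hom_inv_id := by
    haveI := mono_pullback_map_fixι g φ
    rw [← cancel_mono ((Over.pullback g).map (fixι φ)), Category.id_comp, Category.assoc, Category.assoc,
      baseChangeIso_inv_comp_map_fixι, GroupSchemeKernel.kerLift_ι]
    exact fixLift_ι _ _ (map_fixι_comp_map g φ)
  inv_hom_id := by
    apply fix_hom_ext
    rw [Category.id_comp, Category.assoc, Category.assoc, fixLift_ι, baseChangeIso_inv_comp_map_fixι,
      GroupSchemeKernel.kerLift_ι]

/-- `fixBaseChangeIso.hom ≫ ι_{φ ×_S S′} = (ι_φ) ×_S S′`. [cite: GortzWedhorn2020, Definition 4.45 (2) (p. 117)] -/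
@[reassoc (attr := simp)]
theorem fixBaseChangeIso_hom_comp_fixι :
    (fixBaseChangeIso g φ).hom ≫ fixι ((Over.pullback g).map φ) = (Over.pullback g).map (fixι φ) :=
  fixLift_ι _ _ (map_fixι_comp_map g φ)

/-- `fixBaseChangeIso.inv ≫ (ι_φ) ×_S S′ = ι_{φ ×_S S′}`. [cite: GortzWedhorn2020, Definition 4.45 (2) (p. 117)] -/
@[reassoc (attr := simp)]
theorem fixBaseChangeIso_inv_comp_map_fixι :
    (fixBaseChangeIso g φ).inv ≫ (Over.pullback g).map (fixι φ) = fixι ((Over.pullback g).map φ) := by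
  rw [Iso.inv_comp_eq, fixBaseChangeIso_hom_comp_fixι]

/-- `fixBaseChangeIso.hom` is a homomorphism (transported group laws; commutative `G`, homomorphism `φ`).
[cite: GortzWedhorn2020, (4.15) (p. 116)] -/
theorem isMonHom_fixBaseChangeIso_hom [IsCommMonObj G] [IsMonHom φ] :
    letI := fixGrpObj φ; letI := fixGrpObj ((Over.pullback g).map φ); IsMonHom (fixBaseChangeIso g φ).hom := by
  letI := fixGrpObj φ
  haveI := isMonHom_fixι φ
  exact isMonHom_fixLift ((Over.pullback g).map φ) ((Over.pullback g).map (fixι φ)) (map_fixι_comp_map g φ)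

/-- `fixBaseChangeIso.inv` is a homomorphism. [cite: GortzWedhorn2020, (4.15) (p. 116)] -/
theorem isMonHom_fixBaseChangeIso_inv [IsCommMonObj G] [IsMonHom φ] :
    letI := fixGrpObj φ; letI := fixGrpObj ((Over.pullback g).map φ); IsMonHom (fixBaseChangeIso g φ).inv := by
  letI := fixGrpObj φ
  letI := fixGrpObj ((Over.pullback g).map φ)
  haveI := isMonHom_fixBaseChangeIso_hom g φ
  infer_instance

/-- **The rank of `Fix (φ ×_S S′) → S′` at `s′` is the rank of `Fix φ → S` at `g s′`** (for `Fix φ → S` finite flat): `Fix` commutes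
with base change and ranks are stable under base change ([StacksProject] Tag 02KA; Mathlib `Scheme.Hom.finrank_pullback_snd`).
[cite: StacksProject, Tag 02KA] [cite: GortzWedhorn2020, Definition 4.45 (2) (p. 117)] -/
theorem finrank_fix_pullback_map_hom [IsFinite (fix φ).hom] [Flat (fix φ).hom] (s' : S') :
    (fix ((Over.pullback g).map φ)).hom.finrank s' = (fix φ).hom.finrank (g s') := by
  have hw : (fix ((Over.pullback g).map φ)).hom = (fixBaseChangeIso g φ).inv.left ≫ ((Over.pullback g).obj (fix φ)).hom :=
    (Over.w (fixBaseChangeIso g φ).inv).symm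
  haveI : IsIso (fixBaseChangeIso g φ).inv.left := inferInstanceAs (IsIso ((Over.forget S').map (fixBaseChangeIso g φ).inv))
  haveI : IsFinite ((Over.pullback g).obj (fix φ)).hom := by
    change IsFinite (pullback.snd (fix φ).hom g); infer_instance
  haveI : Flat ((Over.pullback g).obj (fix φ)).hom := by
    change Flat (pullback.snd (fix φ).hom g); infer_instance
  rw [hw, Scheme.Hom.finrank_comp_left_of_isIso]
  change Scheme.Hom.finrank (pullback.snd (fix φ).hom g) s' = _
  rw [Scheme.Hom.finrank_pullback_snd]

end BaseChange

end IdempotentSplitting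

/-! ## §2 Base change of homomorphisms of Barsotti–Tate groups -/

namespace BTGroup

namespace Hom

variable {S S' : Scheme.{u}} {p h h' h'' : ℕ} {B : BTGroup S p h} {B' : BTGroup S p h'} {B'' : BTGroup S p h''} (g : S' ⟶ S)

/-- **BASE CHANGE OF A HOMOMORPHISM of Barsotti–Tate groups** along `g : S′ → S`: layerwise `F_n ×_S S′` (homomorphisms for the
transported group laws, compatible with the base-changed transitions by functoriality). [cite: Messing1972, Ch. I (1.1)–(1.6)]
[cite: Tate1967, §2 (2.1)] -/
def baseChange (F : Hom B B') : Hom (B.baseChange g) (B'.baseChange g) where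
  app n := (Over.pullback g).map (F.app n)
  isMonHom_app n := by
    letI := B.grpObj n
    letI := B'.grpObj n
    haveI := F.isMonHom_app n
    infer_instance
  incl_comp_app n := by
    change (Over.pullback g).map (B.incl n) ≫ (Over.pullback g).map (F.app (n + 1)) =
      (Over.pullback g).map (F.app n) ≫ (Over.pullback g).map (B'.incl n)
    rw [← Functor.map_comp, F.incl_comp_app, Functor.map_comp]

/-- Unfolding: the layers of `F ×_S S′` are the `F_n ×_S S′`. [cite: Messing1972, Ch. I (1.1)–(1.6)] -/
@[simp] theorem baseChange_app (F : Hom B B') (n : ℕ) : (F.baseChange g).app n = (Over.pullback g).map (F.app n) := rfl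

/-- `(𝟙_B) ×_S S′ = 𝟙`. [cite: Messing1972, Ch. I (1.1)–(1.6)] -/
@[simp] theorem baseChange_id : (Hom.id B).baseChange g = Hom.id (B.baseChange g) := by
  refine Hom.ext fun n => ?_
  rw [baseChange_app, id_app, id_app]
  exact (Over.pullback g).map_id _

/-- `(F ≫ G) ×_S S′ = (F ×_S S′) ≫ (G ×_S S′)`. [cite: Messing1972, Ch. I (1.1)–(1.6)] -/
theorem baseChange_comp (F : Hom B B') (G : Hom B' B'') :
    (F.comp G).baseChange g = (F.baseChange g).comp (G.baseChange g) := by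
  refine Hom.ext fun n => ?_
  rw [baseChange_app, comp_app, comp_app, baseChange_app, baseChange_app]
  exact (Over.pullback g).map_comp _ _

/-- An idempotent endomorphism stays idempotent after base change. [cite: Messing1972, Ch. I (1.1)–(1.6)] -/
theorem baseChange_idem (ε : Hom B B) (hε : ∀ n, ε.app n ≫ ε.app n = ε.app n) (n : ℕ) :
    (ε.baseChange g).app n ≫ (ε.baseChange g).app n = (ε.baseChange g).app n := by
  rw [baseChange_app, ← Functor.map_comp, hε n]

/-- Commutation relations `φ_n ≫ ε′_n = ε_n ≫ φ_n` are preserved by base change. [cite: Messing1972, Ch. I (1.1)–(1.6)] -/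
theorem baseChange_comm (ε : Hom B B) (ε' : Hom B' B') (φ : Hom B B')
    (hφ : ∀ n, φ.app n ≫ ε'.app n = ε.app n ≫ φ.app n) (n : ℕ) :
    (φ.baseChange g).app n ≫ (ε'.baseChange g).app n = (ε.baseChange g).app n ≫ (φ.baseChange g).app n := by
  rw [baseChange_app, baseChange_app, baseChange_app, ← Functor.map_comp, hφ n, Functor.map_comp]

/-! ## §3 `Fix ε` commutes with base change, as Barsotti–Tate groups -/

variable (ε : Hom B B) (hε : ∀ n, ε.app n ≫ ε.app n = ε.app n) (h₁ : ℕ)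
  (hrank : ∀ n (s : S), (ε.fixLayer n).hom.finrank s = p ^ (n * h₁))

/-- The layers of `Fix (ε ×_S S′)` unfold to `Fix (ε_n ×_S S′)` (same transported group law). [cite: Tate1967, §2 (2.1)] -/
theorem fixLayer_baseChange (n : ℕ) :
    (ε.baseChange g).fixLayer n = (letI := B.grpObj n; IdempotentSplitting.fix ((Over.pullback g).map (ε.app n))) := rfl

include hε in
/-- **The rank function of the layers of `Fix (ε ×_S S′)` is the pulled-back one**: `rk_{s′} Fix(ε_n ×_S S′) = rk_{g s′} Fix ε_n`
(idempotent `ε`, so the layers of `Fix ε` are finite flat). [cite: StacksProject, Tag 02KA] [cite: Messing1972, Ch. I (1.1)–(1.6)] -/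
theorem finrank_fixLayer_baseChange (n : ℕ) (s' : S') :
    ((ε.baseChange g).fixLayer n).hom.finrank s' = (ε.fixLayer n).hom.finrank (g s') := by
  letI := B.grpObj n
  haveI : IsFinite (IdempotentSplitting.fix (ε.app n)).hom := ε.isFinite_fixLayer_hom n
  haveI : Flat (IdempotentSplitting.fix (ε.app n)).hom := ε.flat_fixLayer_hom hε n
  exact IdempotentSplitting.finrank_fix_pullback_map_hom g (ε.app n) s'

include hε hrank in
/-- Hence the rank hypothesis of ★ `fixBTGroup` transports: `rk Fix ε_n = p^{n h₁}` on `S` ⟹ the same for `ε ×_S S′` on `S′`.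
[cite: StacksProject, Tag 02KA] [cite: Tate1967, §2 (2.1)] -/
theorem hrank_baseChange (n : ℕ) (s' : S') : ((ε.baseChange g).fixLayer n).hom.finrank s' = p ^ (n * h₁) := by
  rw [finrank_fixLayer_baseChange g ε hε n s', hrank]

/-- **`Fix` COMMUTES WITH BASE CHANGE, as Barsotti–Tate groups: `(Fix ε) ×_S S′ ≅ Fix (ε ×_S S′)`** (canonical isomorphism of
Barsotti–Tate groups over `S′`; layers ★ `IdempotentSplitting.fixBaseChangeIso`, compatible with the transitions because both sides
project to `(ι_n ≫ incl n) ×_S S′`). [cite: Messing1972, Ch. I (1.1)–(1.6)] [cite: GortzWedhorn2020, (4.15) (p. 116) and Definition 4.45 (2) (p. 117)] -/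
def fixBTGroupBaseChangeIso :
    Iso ((ε.fixBTGroup hε h₁ hrank).baseChange g)
      ((ε.baseChange g).fixBTGroup (baseChange_idem g ε hε) h₁ (hrank_baseChange g ε hε h₁ hrank)) where
  hom :=
    { app := fun n => letI := B.grpObj n; (IdempotentSplitting.fixBaseChangeIso g (ε.app n)).hom
      isMonHom_app := fun n => by
        letI := B.grpObj n
        haveI := B.comm n
        haveI := ε.isMonHom_app n
        exact IdempotentSplitting.isMonHom_fixBaseChangeIso_hom g (ε.app n)
      incl_comp_app := fun n => by
        letI := B.grpObj n
        letI := B.grpObj (n + 1)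
        haveI := IdempotentSplitting.mono_fixι ((Over.pullback g).map (ε.app (n + 1)))
        rw [← cancel_mono (IdempotentSplitting.fixι ((Over.pullback g).map (ε.app (n + 1))))]
        change ((Over.pullback g).map (ε.fixIncl n) ≫ (IdempotentSplitting.fixBaseChangeIso g (ε.app (n + 1))).hom) ≫
            IdempotentSplitting.fixι ((Over.pullback g).map (ε.app (n + 1))) =
          ((IdempotentSplitting.fixBaseChangeIso g (ε.app n)).hom ≫ (ε.baseChange g).fixIncl n) ≫
            IdempotentSplitting.fixι ((Over.pullback g).map (ε.app (n + 1)))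
        rw [Category.assoc, Category.assoc, IdempotentSplitting.fixBaseChangeIso_hom_comp_fixι, ← Functor.map_comp]
        change (Over.pullback g).map (ε.fixIncl n ≫ ε.fixLayerι (n + 1)) =
          (IdempotentSplitting.fixBaseChangeIso g (ε.app n)).hom ≫ (ε.baseChange g).fixIncl n ≫ (ε.baseChange g).fixLayerι (n + 1)
        rw [ε.fixIncl_ι, (ε.baseChange g).fixIncl_ι, Functor.map_comp]
        change _ = (IdempotentSplitting.fixBaseChangeIso g (ε.app n)).hom ≫
          IdempotentSplitting.fixι ((Over.pullback g).map (ε.app n)) ≫ (Over.pullback g).map (B.incl n)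
        rw [IdempotentSplitting.fixBaseChangeIso_hom_comp_fixι_assoc] }
  inv :=
    { app := fun n => letI := B.grpObj n; (IdempotentSplitting.fixBaseChangeIso g (ε.app n)).inv
      isMonHom_app := fun n => by
        letI := B.grpObj n
        haveI := B.comm n
        haveI := ε.isMonHom_app n
        exact IdempotentSplitting.isMonHom_fixBaseChangeIso_inv g (ε.app n)
      incl_comp_app := fun n => by
        letI := B.grpObj n
        letI := B.grpObj (n + 1)
        haveI := IdempotentSplitting.mono_pullback_map_fixι g (ε.app (n + 1))
        rw [← cancel_mono ((Over.pullback g).map (IdempotentSplitting.fixι (ε.app (n + 1))))]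
        change ((ε.baseChange g).fixIncl n ≫ (IdempotentSplitting.fixBaseChangeIso g (ε.app (n + 1))).inv) ≫
            (Over.pullback g).map (ε.fixLayerι (n + 1)) =
          ((IdempotentSplitting.fixBaseChangeIso g (ε.app n)).inv ≫ (Over.pullback g).map (ε.fixIncl n)) ≫
            (Over.pullback g).map (ε.fixLayerι (n + 1))
        rw [Category.assoc, Category.assoc, ← Functor.map_comp, ε.fixIncl_ι, Functor.map_comp]
        change (ε.baseChange g).fixIncl n ≫ (IdempotentSplitting.fixBaseChangeIso g (ε.app (n + 1))).inv ≫
            (Over.pullback g).map (IdempotentSplitting.fixι (ε.app (n + 1))) =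
          (IdempotentSplitting.fixBaseChangeIso g (ε.app n)).inv ≫
            (Over.pullback g).map (IdempotentSplitting.fixι (ε.app n)) ≫ (Over.pullback g).map (B.incl n)
        rw [IdempotentSplitting.fixBaseChangeIso_inv_comp_map_fixι, IdempotentSplitting.fixBaseChangeIso_inv_comp_map_fixι_assoc]
        exact (ε.baseChange g).fixIncl_ι n }
  hom_inv_id := by
    refine Hom.ext fun n => ?_
    letI := B.grpObj n
    rw [comp_app, id_app]
    exact (IdempotentSplitting.fixBaseChangeIso g (ε.app n)).hom_inv_id
  inv_hom_id := by
    refine Hom.ext fun n => ?_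
    letI := B.grpObj n
    rw [comp_app, id_app]
    exact (IdempotentSplitting.fixBaseChangeIso g (ε.app n)).inv_hom_id

/-- The layers of the comparison isomorphism followed by `ι_{ε_n ×_S S′}` are `(ι_n) ×_S S′`.
[cite: GortzWedhorn2020, Definition 4.45 (2) (p. 117)] -/
theorem fixBTGroupBaseChangeIso_hom_app_comp_fixLayerι (n : ℕ) :
    (fixBTGroupBaseChangeIso g ε hε h₁ hrank).hom.app n ≫ (ε.baseChange g).fixLayerι n =
      (Over.pullback g).map (ε.fixLayerι n) := by
  letI := B.grpObj n
  exact IdempotentSplitting.fixBaseChangeIso_hom_comp_fixι g (ε.app n)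

/-- … equivalently: `(comparison).hom ≫ fixBTGroupι (ε ×_S S′) = (fixBTGroupι ε) ×_S S′`. [cite: Tate1967, §2 (2.1)] -/
theorem fixBTGroupBaseChangeIso_hom_comp_fixBTGroupι :
    (fixBTGroupBaseChangeIso g ε hε h₁ hrank).hom.comp
        ((ε.baseChange g).fixBTGroupι (baseChange_idem g ε hε) h₁ (hrank_baseChange g ε hε h₁ hrank)) =
      (ε.fixBTGroupι hε h₁ hrank).baseChange g := by
  refine Hom.ext fun n => ?_
  rw [comp_app, fixBTGroupι_app, baseChange_app, fixBTGroupι_app]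
  exact fixBTGroupBaseChangeIso_hom_app_comp_fixLayerι g ε hε h₁ hrank n

/-! ## §4 Over a local base the rank function of the layers of `Fix ε` is constant -/

/-- **Over `Spec R` with `R` LOCAL, the rank of `Fix ε_n → Spec R` is the same at every point** (a finite flat module over a local
ring is free, [Matsumura1987] Thm. 7.10; ★ `finrank_eq_finrank_closedPoint_of_isLocalRing`).  So the rank hypothesis `hrank` of ★
`fixBTGroup` holds on `Spec R` as soon as it holds at the closed point — or, by §3, at any point of any base change (e.g. the
generic point `Spec Ω → Spec 𝒪_Ω`, characteristic `0`). [cite: Matsumura1987, Thm. 7.10] [cite: StacksProject, Tag 02KA] -/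
theorem finrank_fixLayer_eq_finrank_closedPoint {R : Type u} [CommRing R] [IsLocalRing R] {B₀ : BTGroup (Spec (.of R)) p h}
    (ε₀ : Hom B₀ B₀) (hε₀ : ∀ n, ε₀.app n ≫ ε₀.app n = ε₀.app n) (n : ℕ) (s : ↥(Spec (.of R))) :
    (ε₀.fixLayer n).hom.finrank s = (ε₀.fixLayer n).hom.finrank (IsLocalRing.closedPoint R) := by
  haveI := ε₀.isFinite_fixLayer_hom n
  haveI := ε₀.flat_fixLayer_hom hε₀ n
  exact Morphisms.finrank_eq_finrank_closedPoint_of_isLocalRing _ s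

/-- Over a local base, `hrank` at the closed point gives `hrank` everywhere. [cite: Matsumura1987, Thm. 7.10] [cite: Tate1967, §2 (2.1)] -/
theorem hrank_of_closedPoint {R : Type u} [CommRing R] [IsLocalRing R] {B₀ : BTGroup (Spec (.of R)) p h}
    (ε₀ : Hom B₀ B₀) (hε₀ : ∀ n, ε₀.app n ≫ ε₀.app n = ε₀.app n) {h₀ : ℕ}
    (h0 : ∀ n, (ε₀.fixLayer n).hom.finrank (IsLocalRing.closedPoint R) = p ^ (n * h₀)) (n : ℕ) (s : ↥(Spec (.of R))) :
    (ε₀.fixLayer n).hom.finrank s = p ^ (n * h₀) := by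
  rw [finrank_fixLayer_eq_finrank_closedPoint ε₀ hε₀ n s, h0]

/-- Over a local base, `hrank` at ANY point `g s′` hit by a base change `g : S′ → Spec R` (e.g. the generic point) gives `hrank`
everywhere on `Spec R` — read through §3 this is «the rank of `Fix ε` over `κ̄` equals its rank over `Ω`».
[cite: Matsumura1987, Thm. 7.10] [cite: StacksProject, Tag 02KA] -/
theorem hrank_of_baseChange_point {R : Type u} [CommRing R] [IsLocalRing R] {B₀ : BTGroup (Spec (.of R)) p h}
    (ε₀ : Hom B₀ B₀) (hε₀ : ∀ n, ε₀.app n ≫ ε₀.app n = ε₀.app n) {S'' : Scheme.{u}} (g₀ : S'' ⟶ Spec (.of R)) (s'' : S'')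
    {h₀ : ℕ} (h0 : ∀ n, ((ε₀.baseChange g₀).fixLayer n).hom.finrank s'' = p ^ (n * h₀)) (n : ℕ) (s : ↥(Spec (.of R))) :
    (ε₀.fixLayer n).hom.finrank s = p ^ (n * h₀) := by
  rw [finrank_fixLayer_eq_finrank_closedPoint ε₀ hε₀ n s, ← finrank_fixLayer_eq_finrank_closedPoint ε₀ hε₀ n (g₀ s''),
    ← finrank_fixLayer_baseChange g₀ ε₀ hε₀ n s'', h0]

end Hom

end BTGroup

end Literature.AlgebraicGeometry.GroupSchemes

end
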